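import Literature.MathematicalPhysics.QuantumFieldTheory.Balaban1983to89.B8Eq137QjEqB
import Literature.MathematicalPhysics.QuantumFieldTheory.Balaban1983to89.BlockAveragingExpMeanLog

/-!
# `Balaban1983to89.B8Eq131UnitaryLog` — [Balaban1985RegularSpaces] (1.31)/(1.37): the configuration `B = (1/i) log Ū₁ʲ`
# for UNITARY gauge groups (`G = U(N) ⊂ M_N(ℂ)`, any C⋆-algebra) IS the PRINCIPAL logarithm (22)–(23) of [3] —
# `B_b = arg(Ū₁ʲ)_b`, a HERMITIAN (`𝔤`-valued) element with (24)–(25) — the series/principal identification that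
# `B8Thm2LogB` HONEST SCOPE (iii) and the cell's row B8.Eq1.31 «absent:» clause left uninstantiated

statement-level skeleton of published theorems with citation tags; proofs where landed; nothing here is a claim
about the Yang–Mills mass gap

PDF held: `paper:balaban1985-cmp99-regular-spaces-gauge-fixing` (journal page = PDF page + 74); p. 82 [PDF 8] read as an IMAGE
this session (render `…-p008-x2.png`); [3] = T. Bałaban, *Averaging operations for lattice gauge theories*, Commun. Math. Phys.
**98** (1985) 17–51 [Balaban1985Averaging] (21)–(25) p. 21 through the tree modules `MatrixLog` / `BlockAveragingExpMeanLog`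
(whose headers quote the renders).

CITATION HEADER (lean-in-tree rule).  Cell `lit-balaban` (HOME `run/shared/lean/pub/lit-balaban/`), unit `lit-balaban-r05`
gen 12 (B8 fold owner).  WHAT IS REPRODUCED = SKELETON rows **B8.Eq1.31** ((1.31): `B := (1/i) log Ū₁ʲ`, «A is a Lie
algebra valued configuration» p. 76 / (1.32) «Q(U₀, ηA) = B») and **B8.Eq1.36** ((1.37)).  Status before this module: the
lineage (`B8Thm2LogB`, `B8Eq131Derivation`, `B8Eq137QjEqB`) works over an abstract complete normed algebra with the SERIES
logarithm (21) (`MatrixLog.mlog`); `B8Thm2LogB` HONEST SCOPE (iii): *"The gauge group is the abstract `U1 𝔸`; for `G = U(N)`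
print's `log` (B7 (22)–(23), principal branch) coincides with the series (21) on `|X − 1| < 1`, so nothing is lost, but no
spectral input (`|log U| ≤ (π/2)|U − 1|`) is used or certified"*; the cell's row B8.Eq1.31 lists «G = U(N) with the
principal-branch log of [3] (22)–(23) not instantiated» in its «absent:» clause.  THIS MODULE instantiates it: in any
C⋆-algebra (so for `U(N)`, `SU(N) ⊂ M_N(ℂ)` under the operator norm, the instance the tree assembles locally — `MatrixLog`),
for a unitary `w` with `|w − 1| < 2 ln 2/π` the (1.31) configuration `B_b = (1/i) log w` (`B8Thm2LogB.Bint`) IS Mathlib's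
principal argument `Unitary.argSelfAdjoint w` (= the `A` of (23), `log U = iA`), hence HERMITIAN with `|B_b| ≤ π` and the
printed (24)–(25); the same for the crossing-bond `B_b` (`Bcross`), whose argument `exp[−iΣ…]V′_b` is itself unitary; and
(1.37)'s `Q_j(U₀, ηA)` is `i`·(Hermitian) at an interior bond.  Kind «kernel-checked proof», theorems only; no `… : Prop`
fact, no definition; REUSED BY NAME: `ExpMeanLog.mlog_coe_unitary_eq_I_smul_arg` (module `BlockAveragingExpMeanLog`) ((21) = (23) on unitaries
near `1`, r18/b-cell), `MatrixLog.unitary_norm_arg_le` / `unitary_norm_sub_one_le_norm_arg` ((24)–(25)),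
`B7Prop2Explicit.star_mlog_eq_neg`, Mathlib `Unitary.argSelfAdjoint`, `NormedSpace.exp_mem_unitary_of_mem_skewAdjoint`,
`B8Thm2LogB.Bint/Bcross/crossMid/crossSum/neg_I_smul_crossSum`, `B8Eq137QjEqB.Qj_eq_Bint`.

WHAT IS PRINTED.  [B8] p. 82 (1.31) *"(Ū₁ʲ)_b = V′_b = exp iB_b … or (1/i) log Ū₁ʲ = B on Λ_j"*, p. 76 *"A is a Lie algebra
valued configuration"*; [3] p. 21 (quoted in `MatrixLog`): *"We will use this definition for log z = log|z| + i arg z, where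
arg z ∈ ]−π, π], and for unitary matrices. Every unitary matrix U can be represented uniquely in the form U = Σ_j e^{iλ_j}P_j,
… and then we define log U = i Σ_j λ_j P_j = iA, (23) A is a hermitian matrix, |A| ≤ π. From this definition the following
inequalities follow: |U − 1| … ≤ |log U|, (24) |log U| ≤ (π/2)|U − 1| (25)"*.

WHAT THIS MODULE PROVES (all statements kernel-checked, 0 sorry; `A` a C⋆-algebra — Mathlib's `CStarAlgebra`, which already carries `‖1‖ = 1`).
§1 INTERIOR `B_b`: for `w : Aˣ` unitary with `‖w − 1‖ < 2 ln 2/π`: **`Bint_eq_arg`** (`Bint w = argSelfAdjoint w`, the `A` of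
   (23)), `isSelfAdjoint_Bint` (HERMITIAN = `𝔤`-valued for `G = U(N)`), `norm_Bint_le_pi` (`|A| ≤ π`), `norm_sub_one_le_norm_Bint`
   ((24)), `norm_Bint_le_pi_half_mul` ((25) `|B_b| ≤ (π/2)|w − 1|`).
§2 CROSSING `B_b`: `covProd_mem` (the contour products (1.19) of `S`-valued data lie in the subgroup `S`),
   `neg_I_smul_crossSum_mem_skewAdjoint` (the exponent `−iΣ_x L^{−d}(1/i) log(…)` of (1.31) is skew-adjoint when the
   contour products are unitary within `1/4` of `1`: (22)–(23) `B7Prop2Explicit.star_mlog_eq_neg`), **`crossMid_mem_unitary`**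
   (`exp[−iΣ…]V′_b` is unitary), **`Bcross_eq_arg`**, `isSelfAdjoint_Bcross`, `norm_Bcross_le_pi_half_mul`.
§3 (1.37) for unitary groups: **`Qj_eq_I_smul_arg_interior`** — `Q_{j+1}(U₀, ηA)_b = i·arg(Ũ′^{j+1}_b)` (from
   `B8Eq137QjEqB.Qj_eq_Bint` and §1), `isSelfAdjoint_Iinv_smul_Qj_interior` (`(1/i)Q_{j+1}(U₀, ηA)_b` is Hermitian).

HONEST SCOPE.  (i) Abstract C⋆-algebra; `U(N) ⊂ M_N(ℂ)` is the instance under Mathlib's `L²`-operator norm, assembled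
locally by users as in `MatrixLog` (Mathlib registers no global `CStarAlgebra (Matrix n n ℂ)`).  (ii) The radius `2 ln 2/π
≈ 0.441` (where the tree certifies (21) = (23), `BlockAveragingExpMeanLog`) replaces print's `|X − 1| < 1`; the lineage's
regime `|Ū − 1| ≤ α₁ ≤ 1/8` is well inside.  (iii) Unitarity of the averages themselves (`Ũ′ʲ_b`, the contour products)
enters as hypotheses — it is [3] Prop. 2's closure (`B7Prop2Explicit.avgIter_mem`/`avgClosed_unitaryUnits`), not re-derived.
(iv) Nothing here is progress on `Summit.QuantumFields`; the value is that `B8Thm2LogB` HONEST SCOPE (iii) / the «U(N)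
principal log» item of row B8.Eq1.31 is now instantiated: B is Hermitian with the printed (24)–(25).

[cite: Balaban1985RegularSpaces, (1.31) p.82, (1.37) p.82, p.76; Balaban1985Averaging, (21)–(25) p.21]
-/

noncomputable section

open NormedSpace Complex

namespace Literature.MathematicalPhysics.QuantumFieldTheory.Balaban1983to89.B8Eq131UnitaryLog

open selfAdjoint Unitary MatrixLog
open B7Prop1Explicit B7Prop2Explicit B7Eq92Concrete B7Eq99Concrete B7Eq84Concrete B7AvgGaugeCovariance
open B7Prop3Flat (expCfg)
open B7Prop4GeneralLevels (logCovIter)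
open B8Lemma1NonAbelian (covProd pert mulCfg)
open B8Thm2LogB (blockTop crossSum crossMid Bint Bcross neg_I_smul_crossSum)
open ExpMeanLog (mlog_coe_unitary_eq_I_smul_arg)
open B8Eq137QjEqB (Qj_eq_Bint)

-- `Site` alone would resolve to the torus sites of `Setup.lean`; re-export the `ℤ^d` sites of `B7Prop1Explicit`.
export B7Prop1Explicit (Site)

variable {d : ℕ} {A : Type*} [CStarAlgebra A]

/-- `2 ln 2/π < 2` (so the radius of (21) = (23) is inside the domain `‖u − 1‖ < 2` of (24)–(25)). [folklore] -/
private theorem two_log_two_div_pi_lt_two : 2 * Real.log 2 / Real.pi < 2 := by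
  rw [div_lt_iff₀ Real.pi_pos]
  have := Real.log_two_lt_d9
  have := Real.pi_gt_three
  linarith

/-! ## §1 Interior bonds: `B_b = (1/i) log w` is the principal argument of the unitary `w` -/

/-- **(1.31)'s `B_b = (1/i) log V′_b` IS the `A` of [3] (23) `log U = iA`** for a unitary `w = V′_b` of a C⋆-algebra with
`|w − 1| < 2 ln 2/π`: `Bint w = arg(w)` (Mathlib `Unitary.argSelfAdjoint`, the principal branch `arg ∈ ]−π, π]` through
the continuous functional calculus; for a unitary matrix `Σ_j e^{iλ_j}P_j ↦ Σ_j λ_jP_j`) — the series logarithm (21) and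
the principal logarithm (23) agree there (`ExpMeanLog.mlog_coe_unitary_eq_I_smul_arg` (module `BlockAveragingExpMeanLog`)).
[cite: Balaban1985RegularSpaces, (1.31) p.82; Balaban1985Averaging, (21)–(23) p.21] -/
theorem Bint_eq_arg {w : Aˣ} (hw : (w : A) ∈ unitary A) (hs : ‖(w : A) - 1‖ < 2 * Real.log 2 / Real.pi) :
    Bint w = (argSelfAdjoint (⟨(w : A), hw⟩ : unitary A) : A) := by
  have h : mlog (w : A) = I • (argSelfAdjoint (⟨(w : A), hw⟩ : unitary A) : A) :=
    mlog_coe_unitary_eq_I_smul_arg (u := ⟨(w : A), hw⟩) hs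
  rw [Bint, h, smul_smul, inv_mul_cancel₀ I_ne_zero, one_smul]

/-- **«A is a hermitian matrix» (23)**: `B_b` is self-adjoint — for `G = U(N)` the configuration `B` of (1.31) is
`𝔤`-valued in print's `(1/i)`-convention («A is a Lie algebra valued configuration», [B8] p. 76).
[cite: Balaban1985RegularSpaces, (1.31) p.82, p.76; Balaban1985Averaging, (23) p.21] -/
theorem isSelfAdjoint_Bint {w : Aˣ} (hw : (w : A) ∈ unitary A) (hs : ‖(w : A) - 1‖ < 2 * Real.log 2 / Real.pi) :
    IsSelfAdjoint (Bint w) := by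
  rw [Bint_eq_arg hw hs]
  exact (argSelfAdjoint _).prop

/-- **«|A| ≤ π» (23)** for `B_b`. [cite: Balaban1985Averaging, (23) p.21; Balaban1985RegularSpaces, (1.31) p.82] -/
theorem norm_Bint_le_pi {w : Aˣ} (hw : (w : A) ∈ unitary A) (hs : ‖(w : A) - 1‖ < 2 * Real.log 2 / Real.pi) :
    ‖Bint w‖ ≤ Real.pi := by
  rw [Bint_eq_arg hw hs]
  exact norm_argSelfAdjoint_le_pi _

/-- **(24) `|U − 1| ≤ |log U|`** for `B_b`: `‖w − 1‖ ≤ ‖B_b‖`. [cite: Balaban1985Averaging, (24) p.21; Balaban1985RegularSpaces, (1.31) p.82] -/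
theorem norm_sub_one_le_norm_Bint {w : Aˣ} (hw : (w : A) ∈ unitary A)
    (hs : ‖(w : A) - 1‖ < 2 * Real.log 2 / Real.pi) : ‖(w : A) - 1‖ ≤ ‖Bint w‖ := by
  rw [Bint_eq_arg hw hs]
  exact unitary_norm_sub_one_le_norm_arg (u := ⟨(w : A), hw⟩) (hs.trans two_log_two_div_pi_lt_two)

/-- **(25) `|log U| ≤ (π/2)|U − 1|`** for `B_b`: `‖B_b‖ ≤ (π/2)‖w − 1‖` — the spectral input `B8Thm2LogB` HONEST SCOPE (iii)
recorded as uncertified (there the series bound (26) `t/(1 − t)` is used instead). [cite: Balaban1985Averaging, (25) p.21; Balaban1985RegularSpaces, (1.37) p.82] -/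
theorem norm_Bint_le_pi_half_mul {w : Aˣ} (hw : (w : A) ∈ unitary A)
    (hs : ‖(w : A) - 1‖ < 2 * Real.log 2 / Real.pi) : ‖Bint w‖ ≤ Real.pi / 2 * ‖(w : A) - 1‖ := by
  rw [Bint_eq_arg hw hs]
  exact unitary_norm_arg_le (u := ⟨(w : A), hw⟩) (hs.trans two_log_two_div_pi_lt_two)

/-! ## §2 Crossing bonds: `exp[−iΣ…]V′_b` is unitary and `B_b` is its principal argument -/

/-- The contour products (1.19)/(1.21) `(R(V₀)V′)(Γ) = covProd V₀ V′ x w` of `S`-valued `V₀`, `V′` lie in the subgroup `S`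
(here: the unitary group). [cite: Balaban1985RegularSpaces, (1.19)–(1.21) p.79] -/
theorem covProd_mem {G : Type*} [Group G] {S : Subgroup G} {V₀ V' : Site d → Fin d → G}
    (hV₀ : ∀ x κ, V₀ x κ ∈ S) (hV' : ∀ x κ, V' x κ ∈ S) :
    ∀ (x : Site d) (w : List (Letter d)), covProd V₀ V' x w ∈ S
  | _, [] => by rw [covProd]; exact S.one_mem
  | x, l :: w => by
    rw [covProd]
    exact S.mul_mem (hV' x l.1)
      (S.mul_mem (S.mul_mem (hV₀ x l.1) (covProd_mem hV₀ hV' (x + l.vec) w)) (S.inv_mem (hV₀ x l.1)))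

/-- **The exponent of (1.31)'s crossing-bond formula is skew-adjoint**: if the contour products
`(R̄ʲ_{0,b₋}V′)(Γ_{b₋,x})`, `x ∈ B(b₋)`, are unitary within `1/4` of `1`, then `−iΣ_x L^{−d}(1/i) log(…) = −Σ_x L^{−d} log(…)`
(`B8Thm2LogB.neg_I_smul_crossSum`) is a real combination of skew-adjoint elements ((22)–(23):
`B7Prop2Explicit.star_mlog_eq_neg`). [cite: Balaban1985RegularSpaces, (1.31) p.82; Balaban1985Averaging, (22)–(23) p.21] -/
theorem neg_I_smul_crossSum_mem_skewAdjoint (L : ℕ) (V₀ V' : Site d → Fin d → Aˣ) (q : Site d)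
    (hP : ∀ r : Fin d → Fin L, ((covProd V₀ V' q (treeWord (boxVec L r)) : Aˣ) : A) ∈ unitary A)
    (hPs : ∀ r : Fin d → Fin L, ‖((covProd V₀ V' q (treeWord (boxVec L r)) : Aˣ) : A) - 1‖ ≤ 1 / 4) :
    (-I) • crossSum L V₀ V' q ∈ skewAdjoint A := by
  rw [neg_I_smul_crossSum]
  refine neg_mem (sum_mem fun r _ => skewAdjoint.smul_mem _ ?_)
  rw [skewAdjoint.mem_iff]
  exact star_mlog_eq_neg (hP r) (hPs r)

/-- **`exp[−iΣ_{x∈B(b₋)} L^{−d}(1/i) log(R̄ʲ_{0,b₋}V′)(Γ_{b₋,x})] · V′_b` is UNITARY** (the argument of `log` in (1.31)'s second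
line): the exponential of a skew-adjoint element is unitary (Mathlib `NormedSpace.exp_mem_unitary_of_mem_skewAdjoint`) and
`V′_b` is unitary. [cite: Balaban1985RegularSpaces, (1.31) p.82; Balaban1985Averaging, (22)–(23) p.21] -/
theorem crossMid_mem_unitary (L : ℕ) (V₀ V' : Site d → Fin d → Aˣ) (q : Site d)
    (hP : ∀ r : Fin d → Fin L, ((covProd V₀ V' q (treeWord (boxVec L r)) : Aˣ) : A) ∈ unitary A)
    (hPs : ∀ r : Fin d → Fin L, ‖((covProd V₀ V' q (treeWord (boxVec L r)) : Aˣ) : A) - 1‖ ≤ 1 / 4)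
    {w : Aˣ} (hw : (w : A) ∈ unitary A) : crossMid L V₀ V' q w ∈ unitary A := by
  letI : NormedAlgebra ℚ A := NormedAlgebra.restrictScalars ℚ ℂ A
  have hexp : exp ((-I) • crossSum L V₀ V' q) ∈ unitary A :=
    NormedSpace.exp_mem_unitary_of_mem_skewAdjoint (neg_I_smul_crossSum_mem_skewAdjoint L V₀ V' q hP hPs)
  rw [crossMid]
  exact Submonoid.mul_mem _ hexp hw

/-- **(1.31)'s crossing-bond `B_b = (1/i) log(exp[−iΣ…]V′_b)` IS the principal argument (23)** of that unitary, when it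
lies within `2 ln 2/π` of `1` (the lineage's smallness: `B8Thm2LogB.norm_crossMid_sub_one_le`).
[cite: Balaban1985RegularSpaces, (1.31) p.82; Balaban1985Averaging, (21)–(23) p.21] -/
theorem Bcross_eq_arg (L : ℕ) (V₀ V' : Site d → Fin d → Aˣ) (q : Site d)
    (hP : ∀ r : Fin d → Fin L, ((covProd V₀ V' q (treeWord (boxVec L r)) : Aˣ) : A) ∈ unitary A)
    (hPs : ∀ r : Fin d → Fin L, ‖((covProd V₀ V' q (treeWord (boxVec L r)) : Aˣ) : A) - 1‖ ≤ 1 / 4)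
    {w : Aˣ} (hw : (w : A) ∈ unitary A) (hs : ‖crossMid L V₀ V' q w - 1‖ < 2 * Real.log 2 / Real.pi) :
    Bcross L V₀ V' q w
      = (argSelfAdjoint (⟨crossMid L V₀ V' q w, crossMid_mem_unitary L V₀ V' q hP hPs hw⟩ : unitary A) : A) := by
  have h : mlog (crossMid L V₀ V' q w)
      = I • (argSelfAdjoint (⟨crossMid L V₀ V' q w, crossMid_mem_unitary L V₀ V' q hP hPs hw⟩ : unitary A) : A) :=
    mlog_coe_unitary_eq_I_smul_arg (u := ⟨crossMid L V₀ V' q w, crossMid_mem_unitary L V₀ V' q hP hPs hw⟩) hs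
  rw [Bcross, h, smul_smul, inv_mul_cancel₀ I_ne_zero, one_smul]

/-- The crossing-bond `B_b` is self-adjoint (`𝔤`-valued for `G = U(N)`). [cite: Balaban1985RegularSpaces, (1.31) p.82, p.76; Balaban1985Averaging, (23) p.21] -/
theorem isSelfAdjoint_Bcross (L : ℕ) (V₀ V' : Site d → Fin d → Aˣ) (q : Site d)
    (hP : ∀ r : Fin d → Fin L, ((covProd V₀ V' q (treeWord (boxVec L r)) : Aˣ) : A) ∈ unitary A)
    (hPs : ∀ r : Fin d → Fin L, ‖((covProd V₀ V' q (treeWord (boxVec L r)) : Aˣ) : A) - 1‖ ≤ 1 / 4)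
    {w : Aˣ} (hw : (w : A) ∈ unitary A) (hs : ‖crossMid L V₀ V' q w - 1‖ < 2 * Real.log 2 / Real.pi) :
    IsSelfAdjoint (Bcross L V₀ V' q w) := by
  rw [Bcross_eq_arg L V₀ V' q hP hPs hw hs]
  exact (argSelfAdjoint _).prop

/-- **(25) for the crossing-bond `B_b`**: `‖B_b‖ ≤ (π/2)‖exp[−iΣ…]V′_b − 1‖` (and `≤ π`).
[cite: Balaban1985Averaging, (23)/(25) p.21; Balaban1985RegularSpaces, (1.31)/(1.37) p.82] -/
theorem norm_Bcross_le_pi_half_mul (L : ℕ) (V₀ V' : Site d → Fin d → Aˣ) (q : Site d)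
    (hP : ∀ r : Fin d → Fin L, ((covProd V₀ V' q (treeWord (boxVec L r)) : Aˣ) : A) ∈ unitary A)
    (hPs : ∀ r : Fin d → Fin L, ‖((covProd V₀ V' q (treeWord (boxVec L r)) : Aˣ) : A) - 1‖ ≤ 1 / 4)
    {w : Aˣ} (hw : (w : A) ∈ unitary A) (hs : ‖crossMid L V₀ V' q w - 1‖ < 2 * Real.log 2 / Real.pi) :
    ‖Bcross L V₀ V' q w‖ ≤ Real.pi / 2 * ‖crossMid L V₀ V' q w - 1‖ ∧ ‖Bcross L V₀ V' q w‖ ≤ Real.pi := by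
  rw [Bcross_eq_arg L V₀ V' q hP hPs hw hs]
  exact ⟨unitary_norm_arg_le (u := ⟨crossMid L V₀ V' q w, crossMid_mem_unitary L V₀ V' q hP hPs hw⟩)
      (hs.trans two_log_two_div_pi_lt_two), norm_argSelfAdjoint_le_pi _⟩

/-! ## §3 (1.37) for unitary gauge groups: `Q_j(U₀, ηA)_b = i·arg(Ũ′ʲ_b)`, `(1/i)Q_j(U₀, ηA)_b` Hermitian -/

/-- **(1.37) «Q_j(U₀, ηA) = B», interior bond, for a unitary gauge group**: under the hypotheses of
`B8Eq137QjEqB.Qj_eq_Bint` (level-`j` identification `hId`, (87) at `b₋`, `b₊`), if `Ũ′^{j+1}_b` is unitary within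
`2 ln 2/π` of `1`, then `Q_{j+1}(U₀, ηA)_b = i·arg(Ũ′^{j+1}_b)` — the principal logarithm (23) of [3].
[cite: Balaban1985RegularSpaces, (1.37) p.82, (1.31) p.82; Balaban1985Averaging, (23) p.21, (127) p.37] -/
theorem Qj_eq_I_smul_arg_interior (L : ℕ) (U₀ : Site d → Fin d → Aˣ) (B₀ : Site d → Fin d → A) (u : Site d → Aˣ)
    (j : ℕ) (hId : dbavgCovIter L U₀ (expCfg B₀) j = expCfg (logCovIter L U₀ B₀ j)) (y : Site d) (κ : Fin d)
    (hm : uLev L u (j + 1) y = (wrec L U₀ (expCfg B₀) (j + 1) y)⁻¹)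
    (hp : uLev L u (j + 1) (y + e κ) = (wrec L U₀ (expCfg B₀) (j + 1) (y + e κ))⁻¹)
    (hw : ((tildIter L U₀ (mgauge U₀ u (expCfg B₀)) (j + 1) y κ : Aˣ) : A) ∈ unitary A)
    (hs : ‖((tildIter L U₀ (mgauge U₀ u (expCfg B₀)) (j + 1) y κ : Aˣ) : A) - 1‖ < 2 * Real.log 2 / Real.pi) :
    logCovIter L U₀ B₀ (j + 1) y κ
      = I • (argSelfAdjoint (⟨((tildIter L U₀ (mgauge U₀ u (expCfg B₀)) (j + 1) y κ : Aˣ) : A), hw⟩ : unitary A) : A) := by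
  rw [Qj_eq_Bint L U₀ B₀ u j hId y κ hm hp, Bint_eq_arg hw hs]

/-- … hence **`(1/i)·Q_{j+1}(U₀, ηA)_b` is HERMITIAN** (`𝔤`-valued, `G = U(N)`): the lineage's `i`-multiplied
`logCovIter` divided by `i` is self-adjoint. [cite: Balaban1985RegularSpaces, (1.37) p.82, p.76; Balaban1985Averaging, (23) p.21] -/
theorem isSelfAdjoint_Iinv_smul_Qj_interior (L : ℕ) (U₀ : Site d → Fin d → Aˣ) (B₀ : Site d → Fin d → A)
    (u : Site d → Aˣ) (j : ℕ) (hId : dbavgCovIter L U₀ (expCfg B₀) j = expCfg (logCovIter L U₀ B₀ j)) (y : Site d)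
    (κ : Fin d) (hm : uLev L u (j + 1) y = (wrec L U₀ (expCfg B₀) (j + 1) y)⁻¹)
    (hp : uLev L u (j + 1) (y + e κ) = (wrec L U₀ (expCfg B₀) (j + 1) (y + e κ))⁻¹)
    (hw : ((tildIter L U₀ (mgauge U₀ u (expCfg B₀)) (j + 1) y κ : Aˣ) : A) ∈ unitary A)
    (hs : ‖((tildIter L U₀ (mgauge U₀ u (expCfg B₀)) (j + 1) y κ : Aˣ) : A) - 1‖ < 2 * Real.log 2 / Real.pi) :
    IsSelfAdjoint (I⁻¹ • logCovIter L U₀ B₀ (j + 1) y κ) := by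
  rw [Qj_eq_I_smul_arg_interior L U₀ B₀ u j hId y κ hm hp hw hs, smul_smul, inv_mul_cancel₀ I_ne_zero, one_smul]
  exact (argSelfAdjoint _).prop

end Literature.MathematicalPhysics.QuantumFieldTheory.Balaban1983to89.B8Eq131UnitaryLog

end
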